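import Summits.Ventures.Crystal3D.Theorems.StickyWulffConstantPolycrystalWulffBoundSuperTreeChimera

/-!
# `PolycrystalWulffBound`, line `PolyDensity`: the super-grain tree chimera bound for MEASURABLE cells
# (crux `stmt-Ventures-19482`)

Route `StickyWulffConstant` of the venture `Summits/Ventures/Crystal3D`, second prover lane (poly-p2,
gen 13).  `superTree_chimera_lower` (`…SuperTreeChimera`) asks the cells to be OPEN — inherited from the
single-grain engine, where openness made `G + r·T` measurable for Brunn–Minkowski.  In the docking form
nothing needs it (the regions are thickenings and half-spaces, the per-node bound is a hypothesis), and
the rung applies the tree to TRIMMED cells `Q_j ∖ (trim)`, which are only measurable.  This file restates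
the theorem for measurable cells (`superTree_chimera_lower'`); the proof is the same word for word.
WHAT THIS IS NOT: new mathematics; the crux is not claimed.
-/

noncomputable section

open scoped BigOperators InnerProductSpace ENNReal Pointwise
open MeasureTheory Set

namespace Summit.Ventures.Crystal3D.Theorems

open Summit.Ventures.Crystal3D.Cruxes.TextureLiminf.TexShadow (E3)
open Literature.MathematicalPhysics.StatisticalMechanics (fccStacking barlowStacking IsHaggSeq)

/-- **Chimera lower bound for a sorted tree of SUPER-GRAINS, measurable cells** (docking form).  Tree `Fin (N+1)` (root
`0`, parent of `i.succ` is `par i ≤ i`), edge `i` with unit wall normal `n i` and threshold `t i`;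
node reference frames `Aref` with matching cap-volume profiles across every edge (`hprof`); cells `G j`
(measurable, pairwise disjoint, `0 < |⋃ G j| < ∞`) with frames `A j`, assigned to nodes by `nd`; the cells of
node `i.succ` lie in `{t i < ⟪x, n i⟫}`, the cells of node `par i` lie in `{⟪x, n i⟫ < t i}` wherever
`δ`-close to node `i.succ`, cells of non-adjacent distinct nodes are `δ`-separated, `r·2(√5+1) ≤ δ`;
`U ⊇ ⋃_j (G j + r·W(A j))` measurable; and the PER-NODE chimera bound `hnode` (see the file header).
Then `|⋃ G j|^{1/3} + r·32^{1/3} ≤ |U|^{1/3}`. -/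
theorem superTree_chimera_lower' {N M : ℕ} (par : Fin N → Fin (N + 1)) (hpar : ∀ i, (par i : ℕ) ≤ i)
    (n : Fin N → E3) (t : Fin N → ℝ) (hn1 : ∀ i, ‖n i‖ = 1) (Aref : Fin (N + 1) → (E3 ≃ₗᵢ[ℝ] E3))
    (hprof : ∀ i (s : ℝ), volume ({y : E3 | ∀ ν : E3, ⟪y, ν⟫_ℝ ≤ Real.sqrt 2 / 4 *
        ∑ᶠ w ∈ {w | w ∈ fccStacking 1 (Real.sqrt (2 / 3)) ∧ ‖w‖ = 1}, |⟪w, (Aref i.succ).symm ν⟫_ℝ|} ∩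
        {y : E3 | s < ⟪y, n i⟫_ℝ}) =
      volume ({y : E3 | ∀ ν : E3, ⟪y, ν⟫_ℝ ≤ Real.sqrt 2 / 4 *
        ∑ᶠ w ∈ {w | w ∈ fccStacking 1 (Real.sqrt (2 / 3)) ∧ ‖w‖ = 1}, |⟪w, (Aref (par i)).symm ν⟫_ℝ|} ∩
        {y : E3 | s < ⟪y, n i⟫_ℝ}))
    (nd : Fin M → Fin (N + 1)) (G : Fin M → Set E3) (A : Fin M → (E3 ≃ₗᵢ[ℝ] E3))
    (hG : ∀ j, MeasurableSet (G j)) (hdisjG : ∀ j j', j ≠ j' → Disjoint (G j) (G j'))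
    (hGt : ∀ i j, nd j = i.succ → ∀ x ∈ G j, t i < ⟪x, n i⟫_ℝ) {δ : ℝ}
    (hPt : ∀ i j, nd j = par i → ∀ x ∈ G j,
      ⟪x, n i⟫_ℝ < t i ∨ ∀ j', nd j' = i.succ → ∀ y ∈ G j', δ ≤ dist x y)
    (hsep : ∀ j j', nd j ≠ nd j' → (∀ i, ¬ (nd j = par i ∧ nd j' = i.succ)) →
      (∀ i, ¬ (nd j' = par i ∧ nd j = i.succ)) → ∀ x ∈ G j, ∀ y ∈ G j', δ ≤ dist x y)
    (h0 : volume (⋃ j, G j) ≠ 0) (htop : volume (⋃ j, G j) ≠ ⊤)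
    {r : ℝ} (hr : 0 < r) (hrδ : r * (2 * (Real.sqrt 5 + 1)) ≤ δ) {U : Set E3} (hU : MeasurableSet U)
    (hsub : ∀ j, ∀ x ∈ G j, ∀ w ∈ {y : E3 | ∀ ν : E3, ⟪y, ν⟫_ℝ ≤ Real.sqrt 2 / 4 *
        ∑ᶠ w ∈ {w | w ∈ fccStacking 1 (Real.sqrt (2 / 3)) ∧ ‖w‖ = 1}, |⟪w, (A j).symm ν⟫_ℝ|},
      x + r • w ∈ U)
    (hnode : ∀ (f : Fin (N + 1)) (c : Fin N → ℝ) (C : Set E3), MeasurableSet C →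
      volume (⋃ j, ⋃ (_ : nd j = f), G j) ≠ 0 →
      volume ({y : E3 | ∀ ν : E3, ⟪y, ν⟫_ℝ ≤ Real.sqrt 2 / 4 *
          ∑ᶠ w ∈ {w | w ∈ fccStacking 1 (Real.sqrt (2 / 3)) ∧ ‖w‖ = 1}, |⟪w, (Aref f).symm ν⟫_ℝ|} ∩
        ((⋂ i ∈ Finset.univ.filter (fun i => par i = f), {y : E3 | ⟪y, n i⟫_ℝ ≤ c i}) ∩
          ⋂ i ∈ Finset.univ.filter (fun i : Fin N => f = i.succ), {y : E3 | c i < ⟪y, n i⟫_ℝ})) ≠ 0 →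
      (∀ j, nd j = f → ∀ x ∈ G j, ∀ y ∈ {y : E3 | ∀ ν : E3, ⟪y, ν⟫_ℝ ≤ Real.sqrt 2 / 4 *
          ∑ᶠ w ∈ {w | w ∈ fccStacking 1 (Real.sqrt (2 / 3)) ∧ ‖w‖ = 1}, |⟪w, (A j).symm ν⟫_ℝ|} ∩
        ((⋂ i ∈ Finset.univ.filter (fun i => par i = f), {y : E3 | ⟪y, n i⟫_ℝ ≤ c i}) ∩
          ⋂ i ∈ Finset.univ.filter (fun i : Fin N => f = i.succ), {y : E3 | c i < ⟪y, n i⟫_ℝ}),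
        x + r • y ∈ C) →
      volume (⋃ j, ⋃ (_ : nd j = f), G j) ^ ((3 : ℕ)⁻¹ : ℝ) + ENNReal.ofReal r *
        (volume ({y : E3 | ∀ ν : E3, ⟪y, ν⟫_ℝ ≤ Real.sqrt 2 / 4 *
          ∑ᶠ w ∈ {w | w ∈ fccStacking 1 (Real.sqrt (2 / 3)) ∧ ‖w‖ = 1}, |⟪w, (Aref f).symm ν⟫_ℝ|} ∩
        ((⋂ i ∈ Finset.univ.filter (fun i => par i = f), {y : E3 | ⟪y, n i⟫_ℝ ≤ c i}) ∩
          ⋂ i ∈ Finset.univ.filter (fun i : Fin N => f = i.succ), {y : E3 | c i < ⟪y, n i⟫_ℝ}))) ^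
          ((3 : ℕ)⁻¹ : ℝ) ≤
      volume C ^ ((3 : ℕ)⁻¹ : ℝ)) :
    volume (⋃ j, G j) ^ ((3 : ℕ)⁻¹ : ℝ) +
        ENNReal.ofReal r * (ENNReal.ofReal 32) ^ ((3 : ℕ)⁻¹ : ℝ) ≤ volume U ^ ((3 : ℕ)⁻¹ : ℝ) := by
  classical
  -- the bodies
  set body : (E3 ≃ₗᵢ[ℝ] E3) → Set E3 := fun X => {y : E3 | ∀ ν : E3, ⟪y, ν⟫_ℝ ≤ Real.sqrt 2 / 4 *
    ∑ᶠ w ∈ {w | w ∈ fccStacking 1 (Real.sqrt (2 / 3)) ∧ ‖w‖ = 1}, |⟪w, X.symm ν⟫_ℝ|} with hbody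
  have hWball : ∀ X, body X ⊆ Metric.closedBall (0 : E3) (Real.sqrt 5) :=
    fun X => cruxWulffBody_subset_closedBall X
  have hWvol : ∀ X, volume (body X) = ENNReal.ofReal 32 := fun X => volume_cruxWulffBody X
  have h51 : 0 < 2 * (Real.sqrt 5 + 1) := by positivity
  -- the nodes (super-grains)
  set Nd : Fin (N + 1) → Set E3 := fun f => ⋃ j, ⋃ (_ : nd j = f), G j with hNd
  have hmemNd : ∀ f x, x ∈ Nd f ↔ ∃ j, nd j = f ∧ x ∈ G j := by
    intro f x; simp only [hNd, mem_iUnion, exists_prop]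
  have hNdm : ∀ f, MeasurableSet (Nd f) := fun f =>
    MeasurableSet.iUnion fun j => MeasurableSet.iUnion fun _ => hG j
  have hdisjNd : Pairwise fun f g => Disjoint (Nd f) (Nd g) := by
    intro f g hfg
    rw [Set.disjoint_left]
    intro x hx hx'
    obtain ⟨j, hj, hxj⟩ := (hmemNd f x).1 hx
    obtain ⟨j', hj', hxj'⟩ := (hmemNd g x).1 hx'
    have hjj : j ≠ j' := fun e => hfg (hj.symm.trans (e ▸ hj'))
    exact Set.disjoint_left.1 (hdisjG j j' hjj) hxj hxj'
  have hUnion : (⋃ j, G j) = ⋃ f, Nd f := by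
    ext x
    simp only [mem_iUnion, hmemNd]
    exact ⟨fun ⟨j, hx⟩ => ⟨nd j, j, rfl, hx⟩, fun ⟨_, j, _, hx⟩ => ⟨j, hx⟩⟩
  -- volumes, fractions, subtree weights
  set V : ℝ≥0∞ := volume (⋃ j, G j) with hV
  have hVsum : V = ∑ f, volume (Nd f) := by
    rw [hV, hUnion, measure_iUnion (fun f g h => hdisjNd h) hNdm, tsum_fintype]
  have hNdfin : ∀ f, volume (Nd f) ≠ ⊤ := fun f =>
    (lt_of_le_of_lt (measure_mono (hUnion ▸ subset_iUnion Nd f)) htop.lt_top).ne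
  set Vr : ℝ := V.toReal with hVr
  set σ : Fin (N + 1) → ℝ := fun f => (volume (Nd f)).toReal / Vr with hσ
  have hVr0 : 0 < Vr := ENNReal.toReal_pos h0 htop
  have hσ0 : ∀ f, 0 ≤ σ f := fun f => div_nonneg ENNReal.toReal_nonneg hVr0.le
  have hσ1 : ∑ f, σ f = 1 := by
    simp only [hσ]
    rw [← Finset.sum_div, ← ENNReal.toReal_sum (fun f _ => hNdfin f), ← hVsum, div_self hVr0.ne']
  obtain ⟨u, hrec, hu0, hu1, hroot⟩ := exists_subtreeWeights par hpar σ hσ0 hσ1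
  -- exact cap heights of the children, in the parent's reference body and in the child's
  have hs : ∀ i, ∃ s : ℝ, |s| ≤ Real.sqrt 5 + 1 ∧
      volume (body (Aref (par i)) ∩ {y : E3 | s < ⟪y, n i⟫_ℝ}) = ENNReal.ofReal (32 * u i.succ) :=
    fun i => exists_capHeight_eq (Aref (par i)) (n i) (hn1 i) (hu0 _) (hu1 _)
  choose s hsR hsP using hs
  have hsC : ∀ i, volume (body (Aref i.succ) ∩ {y : E3 | s i < ⟪y, n i⟫_ℝ}) =
      ENNReal.ofReal (32 * u i.succ) := by
    intro i
    have h := hprof i (s i)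
    show volume (body (Aref i.succ) ∩ {y : E3 | s i < ⟪y, n i⟫_ℝ}) = ENNReal.ofReal (32 * u i.succ)
    simp only [hbody]
    rw [h]
    exact hsP i
  -- the truncations `H f` and the reference targets `T f = body (Aref f) ∩ H f`
  set H : Fin (N + 1) → Set E3 := fun f =>
    (⋂ i ∈ Finset.univ.filter (fun i => par i = f), {y : E3 | ⟪y, n i⟫_ℝ ≤ s i}) ∩
      ⋂ i ∈ Finset.univ.filter (fun i : Fin N => f = i.succ), {y : E3 | s i < ⟪y, n i⟫_ℝ} with hH
  set T : Fin (N + 1) → Set E3 := fun f => body (Aref f) ∩ H f with hT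
  have hmemC : ∀ f (y : E3), y ∈ (⋂ i ∈ Finset.univ.filter (fun i => par i = f),
      {y : E3 | ⟪y, n i⟫_ℝ ≤ s i}) ↔ ∀ i, par i = f → ⟪y, n i⟫_ℝ ≤ s i := by
    intro f y
    simp only [mem_iInter, Finset.mem_filter, Finset.mem_univ, true_and, mem_setOf_eq]
  have hmemO : ∀ f (y : E3), y ∈ (⋂ i ∈ Finset.univ.filter (fun i : Fin N => f = i.succ),
      {y : E3 | s i < ⟪y, n i⟫_ℝ}) ↔ ∀ i : Fin N, f = i.succ → s i < ⟪y, n i⟫_ℝ := by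
    intro f y
    simp only [mem_iInter, Finset.mem_filter, Finset.mem_univ, true_and, mem_setOf_eq]
  -- target volumes: own cap (volume `32·u f`) minus the children's caps
  have hTvol : ∀ f, ENNReal.ofReal (32 * σ f) ≤ volume (T f) := by
    intro f
    set Own : Set E3 := body (Aref f) ∩ ⋂ i ∈ Finset.univ.filter (fun i : Fin N => f = i.succ),
      {y : E3 | s i < ⟪y, n i⟫_ℝ} with hOwn
    have hOwnvol : volume Own = ENNReal.ofReal (32 * u f) := by
      induction f using Fin.cases with
      | zero =>
        have : Own = body (Aref 0) := by
          rw [hOwn]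
          refine inter_eq_left.2 fun y _ => (hmemO 0 y).2 fun i hi => absurd hi (Fin.succ_ne_zero i).symm
        rw [this, hWvol, hroot, mul_one]
      | succ j₀ =>
        have : Own = body (Aref j₀.succ) ∩ {y : E3 | s j₀ < ⟪y, n j₀⟫_ℝ} := by
          rw [hOwn]
          ext y
          simp only [mem_inter_iff, hmemO]
          constructor
          · rintro ⟨hy, h⟩; exact ⟨hy, h j₀ rfl⟩
          · rintro ⟨hy, h⟩
            refine ⟨hy, fun i hi => ?_⟩
            have hii : j₀ = i := Fin.succ_inj.1 hi
            subst hii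
            exact h
        rw [this, hsC j₀]
    have hcov : Own ⊆ T f ∪ ⋃ i ∈ Finset.univ.filter (fun i => par i = f),
        (body (Aref f) ∩ {y : E3 | s i < ⟪y, n i⟫_ℝ}) := by
      rintro y ⟨hy, hyo⟩
      by_cases h : ∀ i, par i = f → ⟪y, n i⟫_ℝ ≤ s i
      · exact Or.inl ⟨hy, (hmemC f y).2 h, hyo⟩
      · simp only [not_forall, not_le] at h
        obtain ⟨i, hi, hlt⟩ := h
        exact Or.inr (mem_iUnion₂.2 ⟨i, Finset.mem_filter.2 ⟨Finset.mem_univ _, hi⟩, hy, hlt⟩)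
    have hchildvol : ∀ i ∈ Finset.univ.filter (fun i => par i = f),
        volume (body (Aref f) ∩ {y : E3 | s i < ⟪y, n i⟫_ℝ}) = ENNReal.ofReal (32 * u i.succ) := by
      intro i hi
      rw [Finset.mem_filter] at hi
      rw [← hi.2]
      exact hsP i
    have h1 : ENNReal.ofReal (32 * u f) ≤ volume (T f) +
        ∑ i ∈ Finset.univ.filter (fun i => par i = f), ENNReal.ofReal (32 * u i.succ) := by
      rw [← hOwnvol, ← Finset.sum_congr rfl hchildvol]
      exact (measure_mono hcov).trans ((measure_union_le _ _).trans
        (add_le_add le_rfl (measure_biUnion_finset_le _ _)))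
    rw [hrec f, mul_add, Finset.mul_sum, ENNReal.ofReal_add (mul_nonneg (by norm_num) (hσ0 f))
      (Finset.sum_nonneg fun i _ => mul_nonneg (by norm_num) (hu0 _)),
      ENNReal.ofReal_sum_of_nonneg (fun i _ => mul_nonneg (by norm_num) (hu0 _))] at h1
    exact (ENNReal.add_le_add_iff_right (ENNReal.sum_ne_top.2 fun i _ => ENNReal.ofReal_ne_top)).1 h1
  -- the regions
  set ρ : ℝ := r * (Real.sqrt 5 + 1) with hρ
  have hρ0 : 0 < ρ := by positivity
  set a : Fin N → ℝ := fun i => t i + r * s i with ha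
  set R : Fin (N + 1) → Set E3 := fun f =>
    ((⋂ i ∈ Finset.univ.filter (fun i => par i = f),
        ((Metric.thickening ρ (Nd i.succ))ᶜ ∪ {y : E3 | ⟪y, n i⟫_ℝ < a i})) ∩
      ⋂ i ∈ Finset.univ.filter (fun i : Fin N => f = i.succ), {y : E3 | a i < ⟪y, n i⟫_ℝ}) ∩
    Metric.thickening ρ (Nd f) with hR
  have hmemRC : ∀ f (y : E3), y ∈ (⋂ i ∈ Finset.univ.filter (fun i => par i = f),
      ((Metric.thickening ρ (Nd i.succ))ᶜ ∪ {y : E3 | ⟪y, n i⟫_ℝ < a i})) ↔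
      ∀ i, par i = f → y ∈ Metric.thickening ρ (Nd i.succ) → ⟪y, n i⟫_ℝ < a i := by
    intro f y
    simp only [mem_iInter, Finset.mem_filter, Finset.mem_univ, true_and, mem_union, mem_compl_iff,
      mem_setOf_eq]
    exact forall_congr' fun i => forall_congr' fun _ => ⟨fun h hy => h.resolve_left (fun hn => hn hy),
      fun h => (em (y ∈ Metric.thickening ρ (Nd i.succ))).elim (fun hy => Or.inr (h hy)) Or.inl⟩
  have hmemRO : ∀ f (y : E3), y ∈ (⋂ i ∈ Finset.univ.filter (fun i : Fin N => f = i.succ),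
      {y : E3 | a i < ⟪y, n i⟫_ℝ}) ↔ ∀ i : Fin N, f = i.succ → a i < ⟪y, n i⟫_ℝ := by
    intro f y
    simp only [mem_iInter, Finset.mem_filter, Finset.mem_univ, true_and, mem_setOf_eq]
  have hlt_m : ∀ i (c : ℝ), MeasurableSet {y : E3 | c < ⟪y, n i⟫_ℝ} := fun i c =>
    measurableSet_lt measurable_const (measurable_id.inner measurable_const)
  have hgt_m : ∀ i (c : ℝ), MeasurableSet {y : E3 | ⟪y, n i⟫_ℝ < c} := fun i c =>
    measurableSet_lt (measurable_id.inner measurable_const) measurable_const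
  have hRm : ∀ f, MeasurableSet (R f) := fun f =>
    ((Finset.measurableSet_biInter _ fun i _ =>
        (Metric.isOpen_thickening.measurableSet.compl).union (hgt_m i _)).inter
      (Finset.measurableSet_biInter _ fun i _ => hlt_m i _)).inter
      Metric.isOpen_thickening.measurableSet
  -- disjointness of the regions
  have hthick : ∀ f g : Fin (N + 1), (∀ x ∈ Nd f, ∀ y ∈ Nd g, δ ≤ dist x y) →
      Disjoint (Metric.thickening ρ (Nd f)) (Metric.thickening ρ (Nd g)) := by
    intro f g hfg
    rw [Set.disjoint_left]
    intro y hyf hyg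
    obtain ⟨x, hx, hdx⟩ := Metric.mem_thickening_iff.1 hyf
    obtain ⟨x', hx', hdx'⟩ := Metric.mem_thickening_iff.1 hyg
    have h1 : δ ≤ dist x x' := hfg x hx x' hx'
    have h2 : dist x x' < ρ + ρ := (dist_triangle x y x').trans_lt (by
      rw [dist_comm x y]; exact add_lt_add hdx hdx')
    have h3 : 2 * ρ ≤ δ := by rw [hρ]; linarith
    linarith
  have hRadj : ∀ i, Disjoint (U ∩ R (par i)) (U ∩ R i.succ) := by
    intro i
    rw [Set.disjoint_left]
    rintro y ⟨-, ⟨hyc, -⟩, -⟩ ⟨-, ⟨-, hyo⟩, hyt⟩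
    have h1 : ⟪y, n i⟫_ℝ < a i := (hmemRC _ y).1 hyc i rfl hyt
    have h2 : a i < ⟪y, n i⟫_ℝ := (hmemRO _ y).1 hyo i rfl
    exact lt_irrefl _ (h1.trans h2)
  have hdisjR : Pairwise fun f g => Disjoint (U ∩ R f) (U ∩ R g) := by
    intro f g hfg
    by_cases h1 : ∃ i, f = par i ∧ g = i.succ
    · obtain ⟨i, rfl, rfl⟩ := h1
      exact hRadj i
    by_cases h2 : ∃ i, g = par i ∧ f = i.succ
    · obtain ⟨i, rfl, rfl⟩ := h2
      exact (hRadj i).symm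
    simp only [not_exists] at h1 h2
    refine (hthick f g fun x hx y hy => ?_).mono (fun y hy => hy.2.2) (fun y hy => hy.2.2)
    obtain ⟨j, hj, hxj⟩ := (hmemNd f x).1 hx
    obtain ⟨j', hj', hyj'⟩ := (hmemNd g y).1 hy
    subst hj; subst hj'
    exact hsep j j' hfg h1 h2 x hxj y hyj'
  -- the swollen pieces of the cells of node `f` lie in `U ∩ R f`
  have hinc : ∀ j, ∀ x ∈ G j, ∀ p ∈ body (A j) ∩ H (nd j), x + r • p ∈ U ∩ R (nd j) := by
    intro j x hx p hp
    have hp5 : ‖p‖ ≤ Real.sqrt 5 := mem_closedBall_zero_iff.1 (hWball (A j) hp.1)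
    have h1 : ∀ i, ⟪x + r • p, n i⟫_ℝ = ⟪x, n i⟫_ℝ + r * ⟪p, n i⟫_ℝ := fun i => by
      rw [inner_add_left, inner_smul_left]; simp
    have hxNd : x ∈ Nd (nd j) := (hmemNd _ x).2 ⟨j, rfl, hx⟩
    refine ⟨hsub j x hx p hp.1, ⟨(hmemRC _ _).2 fun i hi hz => ?_, (hmemRO _ _).2 fun i hi => ?_⟩, ?_⟩
    · -- near the child node `i.succ`: the point of the parent node lies below the edge plane
      obtain ⟨y, hyL, hdy⟩ := Metric.mem_thickening_iff.1 hz
      obtain ⟨j', hj', hyj'⟩ := (hmemNd _ y).1 hyL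
      have hdist : dist x y < δ :=
        calc dist x y ≤ dist x (x + r • p) + dist (x + r • p) y := dist_triangle _ _ _
          _ = r * ‖p‖ + dist (x + r • p) y := by
              rw [dist_eq_norm, sub_add_cancel_left, norm_neg, norm_smul, Real.norm_of_nonneg hr.le]
          _ < r * Real.sqrt 5 + ρ := add_lt_add_of_le_of_lt (by gcongr) hdy
          _ ≤ δ := by rw [hρ]; nlinarith
      have hxt : ⟪x, n i⟫_ℝ < t i := by
        rcases hPt i j hi.symm x hx with h | h
        · exact h
        · exact absurd (h j' hj' y hyj') (not_le.2 hdist)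
      have hpi : ⟪p, n i⟫_ℝ ≤ s i := (hmemC _ p).1 hp.2.1 i hi
      show ⟪x + r • p, n i⟫_ℝ < t i + r * s i
      rw [h1]
      have h2 : r * ⟪p, n i⟫_ℝ ≤ r * s i := mul_le_mul_of_nonneg_left hpi hr.le
      linarith
    · -- own window
      have hxt : t i < ⟪x, n i⟫_ℝ := hGt i j hi x hx
      have hpi : s i < ⟪p, n i⟫_ℝ := (hmemO _ p).1 hp.2.2 i hi
      show t i + r * s i < ⟪x + r • p, n i⟫_ℝ
      rw [h1]
      have h2 : r * s i < r * ⟪p, n i⟫_ℝ := mul_lt_mul_of_pos_left hpi hr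
      linarith
    · rw [Metric.mem_thickening_iff]
      refine ⟨x, hxNd, ?_⟩
      rw [dist_eq_norm, add_sub_cancel_left, norm_smul, Real.norm_of_nonneg hr.le, hρ]
      calc r * ‖p‖ ≤ r * Real.sqrt 5 := by gcongr
        _ < r * (Real.sqrt 5 + 1) := by nlinarith
  -- per-node bounds from `hnode`, summed by the root-form docking lemma
  rw [hV, hUnion]
  refine chimera_lower_of_piece_root_bounds Nd hNdm hdisjNd (hUnion ▸ h0) (hUnion ▸ htop)
    (by norm_num : (0:ℝ) < 32) hr (fun f => U ∩ R f) (fun f => hU.inter (hRm f)) hdisjR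
    (fun f => inter_subset_left) fun f hf0 => ?_
  have hσpos : 0 < σ f := div_pos (ENNReal.toReal_pos hf0 (hNdfin f)) hVr0
  have hT0 : volume (T f) ≠ 0 := fun h0' => by
    have h := hTvol f
    rw [h0'] at h
    exact absurd (le_antisymm h bot_le) (ENNReal.ofReal_pos.2 (by positivity)).ne'
  have hkey := hnode f s (U ∩ R f) (hU.inter (hRm f)) hf0 hT0
    (fun j hj x hx y hy => by have h := hinc j x hx y (hj ▸ hy); rwa [hj] at h)
  have hVeq : (volume (⋃ f, Nd f)).toReal = Vr := by rw [hVr, hV, hUnion]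
  rw [hVeq]
  calc volume (Nd f) ^ ((3 : ℕ)⁻¹ : ℝ) + ENNReal.ofReal r *
        (ENNReal.ofReal (32 * ((volume (Nd f)).toReal / Vr))) ^ ((3 : ℕ)⁻¹ : ℝ)
      ≤ volume (Nd f) ^ ((3 : ℕ)⁻¹ : ℝ) + ENNReal.ofReal r * (volume (T f)) ^ ((3 : ℕ)⁻¹ : ℝ) := by
        gcongr
        exact hTvol f
    _ ≤ volume (U ∩ R f) ^ ((3 : ℕ)⁻¹ : ℝ) := hkey

end Summit.Ventures.Crystal3D.Theorems

end
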